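import HarnessLib
import HarnessLib.Audit
import Summits.PneNP.PneNP.Theses.StraightLineSign
import Literature.Computability.AlgebraicComplexity.PosSLP
import Literature.Computability.Complexity.ProbabilisticClasses
import Literature.Computability.Complexity.NPClosureProofs

/-!
# Line `birth` — BC3 skeleton for the crux `PosSLPInPH` (stmt-PneNP-18282)

Route `StraightLineSign` (route-PneNP-StraightLineSign), crux (rank 2) `PosSLPInPH` = **PosSLP ∈ PH**:
the language of `encodingListNatBool`-codes of flattened division-free straight-line programs over
`{1; +, −, ×}` (value list starts `[1]`; instruction `(op, j, k)` appends `v_j ∘ v_k`, `∘ = +, −, ×`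
for `op % 3 = 0, 1, 2`; out-of-range reads are `0`; value = last entry) with POSITIVE value lies in
the polynomial hierarchy. Definitionally the crux is `Literature.…AlgebraicComplexity.posSLP ∈ PH`
(same `let`-inlined evaluator as `slpStep` / `slpValue`; checked below by `Iff.rfl`).

THE LINE = THE ROUTE'S OWN FORESEEN SPLIT (route header, TWO-LAYER PLAN: `PosSLPInPH ⇐
MonotoneCatchUp → CatchUpGivesPH`), i.e. the Jindal–Saranurak monotone-certificate mechanism
(arXiv:1212.2549, Fact 2, p. 3): a positive integer is MANIFESTLY positive when it is given by a
MONOTONE program (no subtraction, in-range operands — an addition–multiplication chain from `1`,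
all of whose values are `≥ 1`); if subtraction never saves more than a polynomial (`τ₊ ≤ poly(τ)`),
then "guess a polynomial-size monotone program for the same integer and verify equality of the two
values" is a `∃ᵖ·coRP` algorithm for PosSLP, equality of SLP-integers (EquSLP) being in `coRP` by
Schönhage's fingerprinting (ABKM 2009 §2, Prop. 2.2). Three named pieces and a real (short) seam:

* `stub_monotoneCatchUp` — SUBTRACTION SAVES AT MOST A POLYNOMIAL (Jindal–Saranurak's printed open
  problem, arXiv:1212.2549 §1.2 and §4, p. 10; Bürgisser–Jindal arXiv:2307.08008 p. 3): every program
  with positive value has a monotone in-range program of polynomially related LENGTH computing the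
  same integer. Pure arithmetic (no complexity classes): the number-theoretic heart, OPEN, load-bearing.
* `stub_equSLP_coRP` — SCHÖNHAGE: EquSLP ∈ coRP for this encoding (codes of programs with value `0`).
  A printed theorem (Schönhage 1979; ABKM 2009 Prop. 2.2), unformalised: random-modulus fingerprints.
* `stub_monotoneCertificate` — THE CERTIFICATE STEP (JS12 Fact 2 proper): catch-up and EquSLP ∈ coRP
  give `posSLP ∈ ∃ᵖ·coRP`. Formalisation labour: normalise opcodes mod 3, bound the code length of an
  in-range program of length `m` by `poly(m)`, decode/recode pairs in polynomial time, reduce "same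
  value" to EquSLP on the difference program (closure of `coRP` under polynomial-time many-one maps and
  under intersection with a `P`-filter), and positivity of monotone in-range programs (induction).
* the SEAM (sorry-free, proved here): `∃ᵖ·coRP ⊆ ∃ᵖ·Π₁ᵖ = Σ₂ᵖ ⊆ PH` from the tree theorems
  `RP_subset_NP_holds`, `co_mono`, `SigmaP_one_holds`, `PiP_eq_co`, `SigmaP_succ`, `polyExists_mono`,
  `SigmaP_subset_PH`; the level reached is JS12's `Σ₂ᵖ`.
* `posSLP_mem_PH_of_sigs : <stub₁-sig> → <stub₂-sig> → <stub₃-sig> → posSLP ∈ PH` (the composition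
  with explicit hypotheses, conclusion = the crux body) and `PosSLPInPH_of : PosSLPInPH` — THE skeleton
  theorem: the crux BY NAME from the three DECLARED stubs (the only `sorry`s of the file).

Disproof used: none exists for this crux (`ledger crux ls stmt-PneNP-18282`: no workfiles, no
Disproof.lean, no crux ideas, 2026-08-17T13:3xZ). Negatives honoured: the refuter stamps on the item
(rreview R3, rattack) record `ledger negatives --problem PneNP`: 5 entries, none about PosSLP, τ/τ₊ or
SLP identity testing; no stub is an instance of a landed Negative lemma (there is none under
`Theorems/PosSLPInPH/Negative/`). Typing checklist 4c: (iv) no hand-picked exponent — catch-up keeps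
`∃ c` free; (i)–(iii) n/a. BC3 probes (seat folder `bc/probe_crux.lean`, `bc/probe_summit.lean`):
`stub → PosSLPInPH` and `stub → PneNP` by `first | exact? | simpa | aesop` FAIL for all three stubs
(outputs in the seat's NOTES.md and in `Lines/birth.md`). Planner planner-skel-stmt-PneNP-18282-0, 2026-08-17.
-/

set_option linter.dupNamespace false
set_option linter.unusedVariables false

noncomputable section

namespace Summit.PneNP.PneNP.Cruxes.PosSLPInPH.Birth

open Literature.Computability.Complexity
open Literature.Computability.AlgebraicComplexity
open Summit.PneNP.PneNP.Theses.StraightLineSign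

/-! ## §0 Identification (sorry-free, definitional) -/

/-- The crux IS `posSLP ∈ PH`: the route decl inlines `slpStep` / `slpValue` as `let`s. [folklore] -/
theorem crux_iff_posSLP_mem_PH :
    Summit.PneNP.PneNP.Theses.StraightLineSign.PosSLPInPH ↔ posSLP ∈ PH :=
  Iff.rfl

/-! ## §1 The three registered stubs -/

/-- **Stub 1 (MONOTONE CATCH-UP = "subtraction saves at most a polynomial"; OPEN PROBLEM, size XL,
LOAD-BEARING).** There is `c` such that every flattened program `prog` with positive value admits a
MONOTONE IN-RANGE program `mprog` — every instruction `(op, j, k)` at position `i` has `op % 3 ≠ 1`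
(no subtraction) and `j, k ≤ i` (operands among the `i + 1` values already computed, the initial `1`
included) — with the same value and `|mprog| ≤ c·|prog|^c + c`. In Jindal–Saranurak's notation:
`τ₊(n) ≤ poly(τ(n))` for all positive integers `n` (our free out-of-range `0` and the opcode
convention change `τ` by `O(1)`). Known: `τ₊(n) = Θ(τ(n))` for almost all `n`; the only proved power
of subtraction is ONE step (`τ₊(2^{2^k} − 1) > τ(2^{2^k} − 1)`). The authors lean towards its failure
(§4) — a superpolynomial gap for an explicit family would kill this line (not the crux).
[cite: arXiv:1212.2549, §1.2 Fact 2 and §4 (open problem)] [cite: arXiv:2307.08008, p. 3] -/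
theorem stub_monotoneCatchUp :
    ∃ c : ℕ, ∀ prog : List (ℕ × ℕ × ℕ), 0 < slpValue prog →
      ∃ mprog : List (ℕ × ℕ × ℕ),
        (∀ i : Fin mprog.length,
          (mprog.get i).1 % 3 ≠ 1 ∧ (mprog.get i).2.1 ≤ (i : ℕ) ∧ (mprog.get i).2.2 ≤ (i : ℕ)) ∧
        slpValue mprog = slpValue prog ∧ mprog.length ≤ c * prog.length ^ c + c := by
  sorry

/-- **Stub 2 (SCHÖNHAGE: EquSLP ∈ coRP; printed theorem, unformalised, size XL).** The language of
codes of flattened programs whose value is `0` is in `coRP`: its complement (non-codes, decided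
outright, together with programs of nonzero value `N`, `|N| ≤ 2^{2^{|prog|}}`) is in `RP` by
evaluating the program modulo a random integer of polynomially many bits — a nonzero `N` has few
prime factors, primes are dense enough (Chebyshev), amplify by repetition.
[cite: AllenderEtAl2009, §2 Prop. 2.2 (EquSLP ∈ coRP, after Schönhage 1979)] -/
theorem stub_equSLP_coRP :
    encodingListNatBool.toLanguage
        {l : List ℕ | ∃ prog : List (ℕ × ℕ × ℕ),
          l = prog.flatMap (fun ins => [ins.1, ins.2.1, ins.2.2]) ∧ slpValue prog = 0} ∈ coRP := by
  sorry

/-- **Stub 3 (THE MONOTONE CERTIFICATE, Jindal–Saranurak Fact 2; formalisation labour, size L).**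
Catch-up and EquSLP ∈ coRP put PosSLP in `∃ᵖ·coRP`: the verifier language is
`{⟨code prog, code mprog⟩ : mprog monotone in-range (opcodes normalised mod 3) ∧ slpValue mprog =
slpValue prog}`; membership of its complement in `RP` is a polynomial-time parse (reject malformed
pairs / non-monotone witnesses outright) followed by Schönhage's test on the difference program
`prog ++ shift(mprog) ++ [(1, last_prog, last_mprog)]`; the witness-length polynomial comes from the
length bound of Stub 1 (an in-range program of length `m` with opcodes `< 3` has code length
`O(m log m)`), and soundness from positivity of monotone in-range programs (all values `≥ 1`).
[cite: arXiv:1212.2549, §1.2 Fact 2] [cite: AllenderEtAl2009, §2] -/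
theorem stub_monotoneCertificate :
    (∃ c : ℕ, ∀ prog : List (ℕ × ℕ × ℕ), 0 < slpValue prog →
      ∃ mprog : List (ℕ × ℕ × ℕ),
        (∀ i : Fin mprog.length,
          (mprog.get i).1 % 3 ≠ 1 ∧ (mprog.get i).2.1 ≤ (i : ℕ) ∧ (mprog.get i).2.2 ≤ (i : ℕ)) ∧
        slpValue mprog = slpValue prog ∧ mprog.length ≤ c * prog.length ^ c + c) →
    encodingListNatBool.toLanguage
        {l : List ℕ | ∃ prog : List (ℕ × ℕ × ℕ),
          l = prog.flatMap (fun ins => [ins.1, ins.2.1, ins.2.2]) ∧ slpValue prog = 0} ∈ coRP →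
    posSLP ∈ polyExists coRP := by
  sorry

/-! ## §2 The seam and the composition (sorry-free) -/

/-- `coRP ⊆ Π₁ᵖ` (`coRP = co RP ⊆ co NP = co Σ₁ᵖ = Π₁ᵖ`). [folklore] -/
theorem coRP_subset_PiP_one : coRP ⊆ PiP 1 := by
  intro L hL
  rw [PiP_eq_co, show SigmaP 1 = Nondeterministic.NP from SigmaP_one_holds]
  exact co_mono RP_subset_NP_holds hL

/-- `∃ᵖ·coRP ⊆ Σ₂ᵖ` (`Σ₂ᵖ = ∃ᵖ·Π₁ᵖ` and monotonicity of `∃ᵖ`). [folklore] -/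
theorem polyExists_coRP_subset_SigmaP_two : polyExists coRP ⊆ SigmaP 2 := by
  rw [SigmaP_succ]
  exact polyExists_mono coRP_subset_PiP_one

/-- **Composition with explicit hypotheses** (BC3 shape `stub₁-sig → stub₂-sig → stub₃-sig → crux
body`): the certificate step gives `posSLP ∈ ∃ᵖ·coRP ⊆ Σ₂ᵖ ⊆ PH`. Its conclusion is the crux's body
(`posSLP ∈ PH`, definitionally the crux), so that `PosSLPInPH_of` below is the file's ONLY theorem
headed by the crux name (what `ledger skeleton check` keys on). [cite: arXiv:1212.2549, §1.2 Fact 2] -/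
theorem posSLP_mem_PH_of_sigs
    (h₁ : ∃ c : ℕ, ∀ prog : List (ℕ × ℕ × ℕ), 0 < slpValue prog →
      ∃ mprog : List (ℕ × ℕ × ℕ),
        (∀ i : Fin mprog.length,
          (mprog.get i).1 % 3 ≠ 1 ∧ (mprog.get i).2.1 ≤ (i : ℕ) ∧ (mprog.get i).2.2 ≤ (i : ℕ)) ∧
        slpValue mprog = slpValue prog ∧ mprog.length ≤ c * prog.length ^ c + c)
    (h₂ : encodingListNatBool.toLanguage
        {l : List ℕ | ∃ prog : List (ℕ × ℕ × ℕ),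
          l = prog.flatMap (fun ins => [ins.1, ins.2.1, ins.2.2]) ∧ slpValue prog = 0} ∈ coRP)
    (h₃ : (∃ c : ℕ, ∀ prog : List (ℕ × ℕ × ℕ), 0 < slpValue prog →
      ∃ mprog : List (ℕ × ℕ × ℕ),
        (∀ i : Fin mprog.length,
          (mprog.get i).1 % 3 ≠ 1 ∧ (mprog.get i).2.1 ≤ (i : ℕ) ∧ (mprog.get i).2.2 ≤ (i : ℕ)) ∧
        slpValue mprog = slpValue prog ∧ mprog.length ≤ c * prog.length ^ c + c) →
      encodingListNatBool.toLanguage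
        {l : List ℕ | ∃ prog : List (ℕ × ℕ × ℕ),
          l = prog.flatMap (fun ins => [ins.1, ins.2.1, ins.2.2]) ∧ slpValue prog = 0} ∈ coRP →
      posSLP ∈ polyExists coRP) :
    posSLP ∈ PH :=
  SigmaP_subset_PH 2 (polyExists_coRP_subset_SigmaP_two (h₃ h₁ h₂))

/-- **THE SKELETON THEOREM.** The crux `Summit.PneNP.PneNP.Theses.StraightLineSign.PosSLPInPH`,
concluded BY NAME from the three DECLARED stubs `stub_monotoneCatchUp`, `stub_equSLP_coRP`,
`stub_monotoneCertificate` (the only `sorry`s of the file) through the sorry-free composition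
`posSLP_mem_PH_of_sigs` and the definitional identification `crux_iff_posSLP_mem_PH`.
[cite: arXiv:1212.2549, §1.2 Fact 2] -/
theorem PosSLPInPH_of : Summit.PneNP.PneNP.Theses.StraightLineSign.PosSLPInPH :=
  crux_iff_posSLP_mem_PH.mpr
    (posSLP_mem_PH_of_sigs stub_monotoneCatchUp stub_equSLP_coRP stub_monotoneCertificate)

end Summit.PneNP.PneNP.Cruxes.PosSLPInPH.Birth

end
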